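import Summits.BirchSwinnertonDyer.BirchSwinnertonDyer.Theses.PrintX11a
import Summits.BirchSwinnertonDyer.BirchSwinnertonDyer.Theorems.ClassRecordThreeCornerAtThreeTwinKatoFacts
import Summits.BirchSwinnertonDyer.BirchSwinnertonDyer.Theorems.ErratumRoadFiveNonSurjCornerBranchesAn
import Summits.BirchSwinnertonDyer.BirchSwinnertonDyer.Theorems.ErratumRoadFiveNonSurjCornerTwinMuAnUnitValue
import Summits.BirchSwinnertonDyer.BirchSwinnertonDyer.Theorems.PrintX11aEulerHalfGlue
import HarnessLib

/-!
# Route `PrintX11a` (cell `bsd-print-x11a`, seat p3 — the exceptional-zero ∕ Euler-system road), crux 3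
# `X11aNonSurjEulerHalf` (item stmt-BirchSwinnertonDyer-20406): the Euler-system half at the NON-surjective
# X11a pairs BY NAME from named facts + Greenberg's `μ = 0` on that locus — nothing else
# (`--supports stmt-BirchSwinnertonDyer-20406`)

THE CRUX (route file `Theses/PrintX11a.lean`, item 20406): for every globally minimal elliptic `W/ℚ` and prime
`p` with `(W,p) ∈ X11a` (`r_an = 0`, `p ≠ 2`, `p ∥ N`, `E[p]` irreducible, no (ram) witness) whose mod-`p`
image is NOT `GL₂(𝔽_p)` (then `p ∈ {3,5,7}`, `p ∣ ord_p Δ_min`, images `3Ns/3Nn/5Ns/5S4/7Ns`,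
`x11a_not_surj_locus`): `Typed.MissingUpperBoundAt W p` (`ord_p #Ш(E) ≤ ord_p #Ш(E)_an`). Print stops exactly
here: Wuthrich 2014 Prop. 21's constant `C` is supported at «primes for which the Galois representation on
`E[p]` is neither surjective nor contained in a Borel subgroup», Kato 2004 Thm. 17.4 (3) asks `SL₂(ℤ_p) ⊆ im ρ`.

WHAT THIS FILE SHOWS (kernel re-plumbing BY NAME of theorems other cells landed for the rank-`0` TWIN of the
X11b corner — which IS a non-surjective X11a pair; the p3 strategy sentence «Kato divisibility at split
multiplicative `p` + Greenberg–Stevens 𝓛-invariant ⇒ r0 upper bound on `#Ш[p^∞]`» is that chain):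

* §1 `x11aNonSurjEulerHalf_of_three_of_five` — the registered-stub glue: the crux ⟸ its `p = 3` part ∧ its
  `p ≥ 5` part (fact-free bookkeeping; `ClassX11a` gives `p ≠ 2`).
* §2 `x11aNonSurjEulerHalf_of_multDivisibility` — Euler-system currency: the crux ⟸ [Stein–Wuthrich 2013
  Thm. 6.1 ×2, GZK, modularity ×2, Greenberg–Stevens] + x11c's typed one-sided cyclotomic divisibility
  `X11b.MultDivisibilityAt W p` (`X(E/ℚ_∞)` torsion, `ϖ·L_p ∈ ι(char_Λ X)` resp. `∈ ι(T·char_Λ X)`) at every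
  non-surjective X11a pair — the engine `X11b.missingUpperBoundAt_of_classX11a_of_multDivisibilityAt`
  (bsd-stepL corner-p1 g4; exceptional zero ∕ 𝓛-invariant inside), ANY odd `p`, no image hypothesis.
* §3 **`x11aNonSurjEulerHalf_of_katoFacts_of_muZero`** — THE HEADLINE: the crux ⟸ TWELVE NAMED Literature
  facts (the six above + Kato 2004 (12.2.1) ∕ Thm. 12.4 ∕ the §17.13 construction facts at a non-split and at a
  split multiplicative odd prime, Greenberg 1999 Thm. 1.5, Wuthrich 2014 Cor. 18 — Kato's divisibility in
  `Λ[1/p]` needs NO image hypothesis) + ONE hypothesis shape: Greenberg's `μ(X(E/ℚ_∞)) = 0` (LNM 1716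
  Conj. 1.11) at every non-surjective X11a pair, every `p` (uniformly `p ∈ {3,5,7}`). Chain =
  `X11b.missingUpperBoundAt_of_katoFacts_of_corollary18_of_mu_eq_zero` (corner-p1 g5 ∘ bsd-2adic GEN 9) per pair.
  READING: the cell's NEW residual (U) is NOT independent of the ladder's barrier B3 — modulo named facts it
  is Greenberg's `μ = 0` RESTRICTED TO THE NON-SURJECTIVE X11a PAIRS (the algebraic `μ`), exactly as the lower
  half (L, item 19064) on the surjective cells is `μ`-shaped through the main conjecture.
* §4 `x11aNonSurjEulerHalf_of_katoFacts_of_muAn` — the ANALYTIC variant: the crux ⟸ THIRTEEN named facts (the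
  twelve + Kato's §17.13 package with the fine quotient at `p ∥ N`, `Kato2004.exists_multDivisibilityInputs_fine`,
  a CONSTRUCTION fact) + the analytic certificate shape «some coefficient of the Néron-normalised
  Mazur–Tate–Teitelbaum function `ϖ·L` is a `p`-adic unit» at every non-surjective X11a pair — through
  corner-p1 g6's KERNEL-CHECKED `μ`-transfer WITHOUT big image at `p ∥ N` (`X11b.MultMu.mu_eq_zero_of_multFine`,
  which USES `Irr ∧ ¬Surj`). PER PAIR the certificate is a finite exact modular-symbol computation (ty3's
  μ-witness engine); class-wide it is Conj. 1.11 through the main conjecture.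
* §5 the `p ≥ 5` part BY NAME from the K2 route's EXISTING objects: `…_five_of_nonSurjCornerTwinMu` (literal
  child `Theorems.NonSurjCornerTwinMu` of ErratumRoadFive's corner split) and `…_five_of_nonSurjCornerTwinMuAn`
  (item stmt-BirchSwinnertonDyer-19948 `Theses.ErratumRoadFive.NonSurjCornerTwinMuAn` BY NAME) — so the `p ≥ 5`
  stub of 20406 ATTACHES to item 19948 (shared staffing, one proof closes both), the locus `p ∈ {5,7} ∧
  p ∣ ord_p Δ_min` being supplied by Balakrishnan et al. 2019 (`hB`) via `x11a_not_surj_locus`; and the whole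
  crux from 19948's literal sibling + a `μ = 0` shape at `p = 3` (`…_of_nonSurjCornerTwinMu_of_muZeroAtThree`).
* §6 the per-pair DOOR on the unit-value locus: at a NON-SPLIT non-surjective X11a pair whose Néron-normalised
  special value `L(E,1)/Ω_E` is a `p`-adic unit, the Euler-system half holds modulo the thirteen facts — the
  constant term `2·L(E,1)/Ω_E` of `ϖ·L` IS the analytic certificate (corner-p1 g7,
  `MuAnUnit.exists_norm_coeff_eq_one_of_neg_one_of_padicValRat_eq_zero`); ONE displayed rational datum per pair.

HONEST FRAMING. THEOREMS ONLY (no definition, no named fact minted, no `sorry`); every theorem is CONDITIONAL on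
the displayed named facts (`def … : Prop` statements of Literature, D-0014 — three of them CONSTRUCTION facts of
cell bsd-2adic ∕ bsd-stepL: `Kato2004.exists_multDivisibilityInputs_{nonsplit,split,fine}`) and on the displayed
hypothesis SHAPES (`μ = 0`, the analytic certificate, the K2 constants); nothing here proves `μ = 0` at any pair;
item 20406 does NOT close; the leaf `ClassX11a` stays open; BSD is not proved by any of this; no census word
moves. «beyond-print theorem: NO» (re-plumbing; the beyond-print content is named: Greenberg's `μ = 0` at an
irreducible non-surjective image, and — for §4/§6 — the cells' kernel-checked `μ`-transfer resting on F1-mult).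

References: [Kato2004Asterisque] Thm. 12.4–12.6 (pp. 221–222), Thm. 16.6 (p. 271), Thm. 17.4 (p. 273), §17.13
(pp. 279–280); [Wuthrich2014] Prop. 21 (p. 400), Cor. 18 (p. 398), p. 391; [Kobayashi2006DocMath] Thm. 4.1;
[SteinWuthrich2013] Thm. 6.1 (p. 20); [GreenbergStevens1993]; [GreenbergLNM1716] Thm. 1.5, Conj. 1.11 (p. 61),
p. 121; [BalakrishnanEtAl2019] Thm. 1.2; [Miller2011LMS] Def. 1.1; tree: `Theorems/ErratumRoadFiveNonSurjCorner
{TwinKatoEngine,TwinKatoRat,TwinKatoFacts,MuTransferMult,BranchesDefs,BranchesAn,TwinMuAnUnitValue}.lean`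
(bsd-stepL corner-p1 g4–g7), `Theorems/ClassRecordThreeCornerAtThreeTwinKatoFacts.lean`,
`Theorems/ByReductionTypeAtTwoMultKatoRatOfInputs.lean` + `Kato2004/DivisibilityInputsMultiplicative.lean`
(bsd-2adic GEN 9), `Theorems/PrintX11aEulerHalfGlue.lean` (this seat g0), HOME/P3-EXCEPTIONAL-ZERO-ROAD.md.
-/

set_option autoImplicit false
set_option linter.dupNamespace false

noncomputable section

open scoped Classical NumberField MatrixGroups ModularForm

open CongruenceSubgroup WeierstrassCurve Field
  Literature.NumberTheory.EllipticCurves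
  Literature.NumberTheory.EllipticCurves.ModularForms
  Literature.NumberTheory.EllipticCurves.Rank1Residual
  Literature.NumberTheory.EllipticCurves.Rank1Residual.Typed
  Literature.NumberTheory.EllipticCurves.Wuthrich2014
  Literature.NumberTheory.EllipticCurves.SteinWuthrich2013
  Literature.NumberTheory.EllipticCurves.Greenberg1999
  Literature.NumberTheory.EllipticCurves.Kato2004
  Literature.NumberTheory.EllipticCurves.BalakrishnanEtAl2019
  Summit.BirchSwinnertonDyer.Rank1Residual
  Summit.BirchSwinnertonDyer.Rank1Residual.X11b

namespace Summit.BirchSwinnertonDyer.BirchSwinnertonDyer.Theorems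

/-! ### §1 The registered-stub glue: `p = 3` part ∧ `p ≥ 5` part ⟹ the crux -/

/-- **Crux 3 `X11aNonSurjEulerHalf` (item 20406) from its two registered parts** — the Euler-system half at the
non-surjective X11a pairs with `p = 3` (images `3Ns/3Nn`) and with `p ≥ 5` (images `5Ns/5S4/7Ns`). Fact-free
bookkeeping: `ClassX11a` carries `p ≠ 2`, and a prime `p ∉ {2,3}` is `≥ 5`. [cite: Miller2011LMS, Def. 1.1 (shape of the halves)] -/
theorem x11aNonSurjEulerHalf_of_three_of_five
    (h₃ : ∀ (W : WeierstrassCurve ℚ) [W.IsElliptic] [W.IsGloballyMinimal] (p : ℕ) [Fact p.Prime],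
      ClassX11a W p → ¬ Surj W p → p = 3 → Typed.MissingUpperBoundAt W p)
    (h₅ : ∀ (W : WeierstrassCurve ℚ) [W.IsElliptic] [W.IsGloballyMinimal] (p : ℕ) [Fact p.Prime],
      ClassX11a W p → ¬ Surj W p → 5 ≤ p → Typed.MissingUpperBoundAt W p) :
    Summit.BirchSwinnertonDyer.BirchSwinnertonDyer.Theses.PrintX11a.X11aNonSurjEulerHalf := by
  intro W _ _ p _ hX hns
  by_cases h3 : p = 3
  · exact h₃ W p hX hns h3
  · have hpP : p.Prime := Fact.out
    have h2 : p ≠ 2 := hX.ne_two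
    have h2le := hpP.two_le
    have h4 : p ≠ 4 := fun h => by rw [h] at hpP; exact absurd hpP (by decide)
    exact h₅ W p hX hns (by omega)

/-- Conversely the crux gives both parts (so the split is lossless). [cite: Miller2011LMS, Def. 1.1 (shape)] -/
theorem x11aNonSurjEulerHalf_parts_of
    (h : Summit.BirchSwinnertonDyer.BirchSwinnertonDyer.Theses.PrintX11a.X11aNonSurjEulerHalf) :
    (∀ (W : WeierstrassCurve ℚ) [W.IsElliptic] [W.IsGloballyMinimal] (p : ℕ) [Fact p.Prime],
      ClassX11a W p → ¬ Surj W p → p = 3 → Typed.MissingUpperBoundAt W p) ∧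
    (∀ (W : WeierstrassCurve ℚ) [W.IsElliptic] [W.IsGloballyMinimal] (p : ℕ) [Fact p.Prime],
      ClassX11a W p → ¬ Surj W p → 5 ≤ p → Typed.MissingUpperBoundAt W p) :=
  ⟨fun W _ _ p _ hX hns _ => h W p hX hns, fun W _ _ p _ hX hns _ => h W p hX hns⟩

/-! ### §2 Euler-system currency: the crux ⟸ x11c's typed one-sided divisibility at the non-surjective pairs -/

/-- **Crux 3 ⟸ [SW13 Thm. 6.1 ×2, GZK, modularity ×2, Greenberg–Stevens] + `X11b.MultDivisibilityAt` at every
non-surjective X11a pair.** The typed divisibility (`X(E/ℚ_∞)` is `Λ`-torsion and `ϖ·L_p(E) ∈ ι(char_Λ X)`,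
resp. `∈ ι(T·char_Λ X)` at a split prime — Kato's ∕ Wuthrich's conclusion WITHOUT the image hypothesis) is
turned into `ord_p #Ш ≤ ord_p #Ш_an` per pair by the corner engine
`X11b.missingUpperBoundAt_of_classX11a_of_multDivisibilityAt` (Stein–Wuthrich Thm. 6.1 in rank `0`, the
interpolation `L(0) = 2[0]⁺_f` resp. Greenberg–Stevens + `𝓛_p ≠ 0`). ANY odd `p`; no image hypothesis.
[cite: SteinWuthrich2013, Thm. 6.1 (p. 20) and §4.2] [cite: GreenbergStevens1993, Thm. (trivial zero)]
[cite: Wuthrich2014, Thm. 3 (p. 383) and Cor. 19 (p. 398) (shape of the divisibility)] [cite: Miller2011LMS, Def. 1.1] -/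
theorem x11aNonSurjEulerHalf_of_multDivisibility
    (hJs : thm61_splitMultiplicative) (hJn : thm61_nonsplitMultiplicative)
    (hGZK : rank_eq_analyticRank_of_analyticRank_le_one) (hmod : hasEntireLFunction_rat)
    (hpar : nonempty_modularParametrizationData)
    (hGS : ∀ (W : WeierstrassCurve ℚ) [W.IsElliptic] [W.IsGloballyMinimal] (p : ℕ) [Fact p.Prime],
      greenberg_stevens (W := W) (p := p))
    (hdiv : ∀ (W : WeierstrassCurve ℚ) [W.IsElliptic] [W.IsGloballyMinimal] (p : ℕ) [Fact p.Prime],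
      ClassX11a W p → ¬ Surj W p → MultDivisibilityAt W p) :
    Summit.BirchSwinnertonDyer.BirchSwinnertonDyer.Theses.PrintX11a.X11aNonSurjEulerHalf := by
  intro W _ _ p _ hX hns
  exact missingUpperBoundAt_of_classX11a_of_multDivisibilityAt hJs hJn hGZK hmod hpar W p (hGS W p) hX
    (hdiv W p hX hns)

/-! ### §3 THE HEADLINE: the crux ⟸ twelve named facts + Greenberg's `μ = 0` at the non-surjective X11a pairs -/

/-- **Crux 3 `X11aNonSurjEulerHalf` (item 20406) modulo TWELVE NAMED Literature facts and ONE hypothesis shape —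
Greenberg's `μ = 0` at the non-surjective X11a pairs.** Facts: Stein–Wuthrich 2013 Thm. 6.1 at a split ∕
non-split prime (`hJs`, `hJn`), Gross–Zagier–Kolyvagin (`hGZK`), modularity (`hmod`, `hpar`), Greenberg–Stevens
(`hGS`), Kato 2004 (12.2.1) (`hne`), Thm. 12.4 (`h12`), the §17.13 inputs at a non-split ∕ split multiplicative
odd prime (`hns`, `hsp`; CONSTRUCTION facts of bsd-2adic, print-backed at odd `p`), Greenberg 1999 Thm. 1.5
(`h15`), Wuthrich 2014 Cor. 18 (`h18`). Shape `hμ`: for every non-surjective X11a pair `(W,p)`, every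
cyclotomic `(κ, γ)` and every Selmer dual datum `D` of `Sel_{p^∞}(E/ℚ_∞)`, `μ(X) = 0` (Greenberg, LNM 1716
Conj. 1.11 at an irreducible image; p. 121 «it seems very difficult to verify this even for specific
examples»). Chain per pair: `X11b.missingUpperBoundAt_of_katoFacts_of_corollary18_of_mu_eq_zero` = Kato's
divisibility in `Λ[1/p]` from the facts (`MultKatoRat.katoMultiplicativeDivisibilityRat_of_facts_odd`, NO image
hypothesis) ∘ period ratio and power of `p` absorbed because `(p) ⊂ ℤ_p⟦T⟧` is prime and `μ = 0` ∘ the rank-`0`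
engine (exceptional zero ∕ 𝓛-invariant). Uniform in `p` (`p = 3` included). CONDITIONAL; closes nothing by itself.
[cite: Kato2004Asterisque, Thm. 12.4 (p. 221), Thm. 12.5–12.6 (p. 222), Thm. 17.4 (p. 273), §17.13 (pp. 279–280)]
[cite: Wuthrich2014, Cor. 18 (p. 398) and Prop. 21 (p. 400) (the excluded image)]
[cite: GreenbergLNM1716, Thm. 1.5 (PDF p. 61); §1 Conj. 1.11 (p. 61) and p. 121 (shape of μ = 0)]
[cite: SteinWuthrich2013, Thm. 6.1 (p. 20)] [cite: Miller2011LMS, Def. 1.1] -/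
theorem x11aNonSurjEulerHalf_of_katoFacts_of_muZero
    (hJs : thm61_splitMultiplicative) (hJn : thm61_nonsplitMultiplicative)
    (hGZK : rank_eq_analyticRank_of_analyticRank_le_one) (hmod : hasEntireLFunction_rat)
    (hpar : nonempty_modularParametrizationData)
    (hGS : ∀ (W : WeierstrassCurve ℚ) [W.IsElliptic] [W.IsGloballyMinimal] (p : ℕ) [Fact p.Prime],
      greenberg_stevens (W := W) (p := p))
    (hne : Kato2004.nonempty_iwasawaH1Data) (h12 : Kato2004.thm12_4)
    (hns : Kato2004.exists_multDivisibilityInputs_nonsplit)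
    (hsp : Kato2004.exists_multDivisibilityInputs_split)
    (h15 : thm15_isTorsion_multiplicative_rat)
    (h18 : Wuthrich2014.corollary18_padicLFunction_mem_iwasawaAlgebra_multiplicative)
    (hμ : ∀ (W : WeierstrassCurve ℚ) [W.IsElliptic] [W.IsGloballyMinimal] (p : ℕ) [Fact p.Prime],
      ClassX11a W p → ¬ Surj W p →
      ∀ (κ : ZpExtension ℚ p) (γ : Field.absoluteGaloisGroup ℚ),
        κ.IsCyclotomic → κ.IsTopGenerator γ → IsCyclotomicVariable p γ →
        ∀ D : W.SelmerDualData κ γ, D.mu = 0) :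
    Summit.BirchSwinnertonDyer.BirchSwinnertonDyer.Theses.PrintX11a.X11aNonSurjEulerHalf := by
  intro W _ _ p _ hX hnsj
  exact missingUpperBoundAt_of_katoFacts_of_corollary18_of_mu_eq_zero hJs hJn hGZK hmod hpar hne h12 hns hsp
    h15 h18 W p (hGS W p) hX.ne_two hX.mult hX.analyticRank_eq_zero (hμ W p hX hnsj)

/-! ### §4 The analytic variant: the crux ⟸ thirteen named facts + an analytic `μ = 0` certificate per pair -/

/-- **Crux 3 modulo THIRTEEN NAMED facts and the ANALYTIC `μ = 0` certificate at the non-surjective X11a pairs.**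
Facts: the twelve of `x11aNonSurjEulerHalf_of_katoFacts_of_muZero` plus Kato's §17.13 package at `p ∥ N` with the
fine quotient (`hfine : Kato2004.exists_multDivisibilityInputs_fine`, CONSTRUCTION fact — the F1 of the corner's
`μ`-transfer). Shape `hAn`: at every non-surjective X11a pair, for every newform `f`, period ratio `ϖ`
(`ϖ·Ω_E = Ω⁺_f`) and Mazur–Tate–Teitelbaum function `L` with allowable root `a = a_p = ±1`, SOME coefficient of
`ϖ·L` is a `p`-adic unit (PER PAIR a finite exact modular-symbol computation). Chain per pair: corner-p1 g6's
`μ`-transfer WITHOUT big image at `p ∥ N` (`X11b.multDivisibilityAt_of_katoFacts_of_muAn`, which uses `Irr ∧ ¬Surj`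
through the reduction-free core `CoreAssembly.coreOdd_anyReduction_holds`) ∘ the rank-`0` engine. Uniform in
`p`. CONDITIONAL; closes nothing by itself.
[cite: Kato2004Asterisque, Thm. 12.6 (p. 222), (14.9.3) (p. 240), §17.13 (pp. 279–280)]
[cite: Wuthrich2014, p. 391 and Cor. 18 (p. 398)] [cite: GreenbergLNM1716, §1 Conj. 1.11 (shape)]
[cite: MazurTateTeitelbaum1986, §I.10 and §I.14 (allowable root a_p at p ∥ N)] [cite: SteinWuthrich2013, Thm. 6.1 (p. 20)] -/
theorem x11aNonSurjEulerHalf_of_katoFacts_of_muAn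
    (hJs : thm61_splitMultiplicative) (hJn : thm61_nonsplitMultiplicative)
    (hGZK : rank_eq_analyticRank_of_analyticRank_le_one) (hmod : hasEntireLFunction_rat)
    (hpar : nonempty_modularParametrizationData)
    (hGS : ∀ (W : WeierstrassCurve ℚ) [W.IsElliptic] [W.IsGloballyMinimal] (p : ℕ) [Fact p.Prime],
      greenberg_stevens (W := W) (p := p))
    (hne : Kato2004.nonempty_iwasawaH1Data) (h12 : Kato2004.thm12_4)
    (hns : Kato2004.exists_multDivisibilityInputs_nonsplit)
    (hsp : Kato2004.exists_multDivisibilityInputs_split)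
    (h15 : thm15_isTorsion_multiplicative_rat)
    (h18 : Wuthrich2014.corollary18_padicLFunction_mem_iwasawaAlgebra_multiplicative)
    (hfine : Kato2004.exists_multDivisibilityInputs_fine)
    (hAn : ∀ (W : WeierstrassCurve ℚ) [W.IsElliptic] [W.IsGloballyMinimal] (p : ℕ) [Fact p.Prime],
      ClassX11a W p → ¬ Surj W p →
      ∀ {N : ℕ} [NeZero N] (f : CuspForm (Gamma0 N) 2), IsNewformOf W f →
      ∀ (ϖ : ℚ), (ϖ : ℝ) * W.realPeriodRat = plusPeriod f →
      ∀ (a : ℚ_[p]) (L : PowerSeries ℚ_[p]),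
        (W.HasSplitMultiplicativeReductionAtPrime p → a = 1) →
        (¬ W.HasSplitMultiplicativeReductionAtPrime p → a = -1) →
        IsMultPAdicLFunctionOf f p a L →
        ∃ n : ℕ, ‖PowerSeries.coeff n (PowerSeries.C ((ϖ : ℚ) : ℚ_[p]) * L)‖ = 1) :
    Summit.BirchSwinnertonDyer.BirchSwinnertonDyer.Theses.PrintX11a.X11aNonSurjEulerHalf := by
  intro W _ _ p _ hX hnsj
  exact missingUpperBoundAt_of_classX11a_of_multDivisibilityAt hJs hJn hGZK hmod hpar W p (hGS W p) hX
    (multDivisibilityAt_of_katoFacts_of_muAn hne h12 hns hsp h15 h18 hfine W p hX.ne_two hX.mult hX.irr hnsj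
      (hAn W p hX hnsj))

/-! ### §5 The `p ≥ 5` part BY NAME from the K2 route's existing objects (shared with item 19948) -/

/-- **The `p ≥ 5` part of crux 3 from the K2 corner's LITERAL child `Theorems.NonSurjCornerTwinMu`**
(Greenberg's `μ = 0` at the non-surjective X11a pairs with `p ∈ {5,7}`, `p ∣ ord_p Δ_min` — file
`ErratumRoadFiveNonSurjCornerBranchesDefs.lean`) and the twelve facts; the locus is supplied from `¬Surj` by
Balakrishnan–Dogra–Müller–Tuitman–Vonk 2019 Thm. 1.2 (`hB`) and Tate's transvection (`x11a_not_surj_locus`).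
CONDITIONAL; closes nothing by itself. [cite: BalakrishnanEtAl2019, §1 Thm. 1.2 (arXiv:1711.05846 p. 2)]
[cite: GreenbergLNM1716, §1 Conj. 1.11 (shape)] [cite: Kato2004Asterisque, §17.13 (pp. 279–280)]
[cite: Wuthrich2014, Cor. 18 (p. 398)] [cite: SteinWuthrich2013, Thm. 6.1 (p. 20)] -/
theorem x11aNonSurjEulerHalf_five_of_nonSurjCornerTwinMu
    (hJs : thm61_splitMultiplicative) (hJn : thm61_nonsplitMultiplicative)
    (hGZK : rank_eq_analyticRank_of_analyticRank_le_one) (hmod : hasEntireLFunction_rat)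
    (hpar : nonempty_modularParametrizationData)
    (hGS : ∀ (W : WeierstrassCurve ℚ) [W.IsElliptic] [W.IsGloballyMinimal] (p : ℕ) [Fact p.Prime],
      greenberg_stevens (W := W) (p := p))
    (hne : Kato2004.nonempty_iwasawaH1Data) (h12 : Kato2004.thm12_4)
    (hns : Kato2004.exists_multDivisibilityInputs_nonsplit)
    (hsp : Kato2004.exists_multDivisibilityInputs_split)
    (h15 : thm15_isTorsion_multiplicative_rat)
    (h18 : Wuthrich2014.corollary18_padicLFunction_mem_iwasawaAlgebra_multiplicative)
    (hB : thm12_not_le_normalizer_splitCartan) (hμ : NonSurjCornerTwinMu) :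
    ∀ (W : WeierstrassCurve ℚ) [W.IsElliptic] [W.IsGloballyMinimal] (p : ℕ) [Fact p.Prime],
      ClassX11a W p → ¬ Surj W p → 5 ≤ p → Typed.MissingUpperBoundAt W p := by
  intro W _ _ p _ hX hnsj hp5
  obtain ⟨h357, hvd, -⟩ := x11a_not_surj_locus hB hX hnsj
  have h57 : p = 5 ∨ p = 7 := by
    rcases h357 with h3 | h57
    · omega
    · exact h57
  exact missingUpperBoundAt_of_katoFacts_of_corollary18_of_mu_eq_zero hJs hJn hGZK hmod hpar hne h12 hns hsp
    h15 h18 W p (hGS W p) hX.ne_two hX.mult hX.analyticRank_eq_zero (hμ W p hX hnsj h57 hvd)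

/-- **The `p ≥ 5` part of crux 3 from ITEM stmt-BirchSwinnertonDyer-19948 BY NAME**
(`Theses.ErratumRoadFive.NonSurjCornerTwinMuAn` := `Theorems.NonSurjCornerTwinMuAn`, the K2 planner's analytic
child of the corner split: a `p`-adic unit coefficient of `ϖ·L` at every non-surjective X11a pair with
`p ∈ {5,7}`, `p ∣ ord_p Δ_min`) and the thirteen facts (F1-mult included); locus from `hB`. So the `p ≥ 5`
registered part of item 20406 is in the cone of item 19948 + named facts: ONE proof closes both.
CONDITIONAL; closes nothing by itself. [cite: BalakrishnanEtAl2019, §1 Thm. 1.2 (arXiv:1711.05846 p. 2)]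
[cite: GreenbergLNM1716, §1 Conj. 1.11 (shape)] [cite: Kato2004Asterisque, §17.13 (pp. 279–280)]
[cite: Wuthrich2014, p. 391 and Cor. 18 (p. 398)] [cite: SteinWuthrich2013, Thm. 6.1 (p. 20)] -/
theorem x11aNonSurjEulerHalf_five_of_nonSurjCornerTwinMuAn
    (hJs : thm61_splitMultiplicative) (hJn : thm61_nonsplitMultiplicative)
    (hGZK : rank_eq_analyticRank_of_analyticRank_le_one) (hmod : hasEntireLFunction_rat)
    (hpar : nonempty_modularParametrizationData)
    (hGS : ∀ (W : WeierstrassCurve ℚ) [W.IsElliptic] [W.IsGloballyMinimal] (p : ℕ) [Fact p.Prime],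
      greenberg_stevens (W := W) (p := p))
    (hne : Kato2004.nonempty_iwasawaH1Data) (h12 : Kato2004.thm12_4)
    (hns : Kato2004.exists_multDivisibilityInputs_nonsplit)
    (hsp : Kato2004.exists_multDivisibilityInputs_split)
    (h15 : thm15_isTorsion_multiplicative_rat)
    (h18 : Wuthrich2014.corollary18_padicLFunction_mem_iwasawaAlgebra_multiplicative)
    (hfine : Kato2004.exists_multDivisibilityInputs_fine)
    (hB : thm12_not_le_normalizer_splitCartan)
    (hAn : Summit.BirchSwinnertonDyer.BirchSwinnertonDyer.Theses.ErratumRoadFive.NonSurjCornerTwinMuAn) :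
    ∀ (W : WeierstrassCurve ℚ) [W.IsElliptic] [W.IsGloballyMinimal] (p : ℕ) [Fact p.Prime],
      ClassX11a W p → ¬ Surj W p → 5 ≤ p → Typed.MissingUpperBoundAt W p := by
  intro W _ _ p _ hX hnsj hp5
  obtain ⟨h357, hvd, -⟩ := x11a_not_surj_locus hB hX hnsj
  have h57 : p = 5 ∨ p = 7 := by
    rcases h357 with h3 | h57
    · omega
    · exact h57
  have hAn' : NonSurjCornerTwinMuAn := hAn
  exact missingUpperBoundAt_of_classX11a_of_multDivisibilityAt hJs hJn hGZK hmod hpar W p (hGS W p) hX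
    (multDivisibilityAt_of_katoFacts_of_muAn hne h12 hns hsp h15 h18 hfine W p hX.ne_two hX.mult hX.irr hnsj
      (fun f hf ϖ hϖ a L hsa hna hL => hAn' W p hX hnsj h57 hvd f hf ϖ hϖ a L hsa hna hL))

/-- **The whole crux from the K2 literal child at `p ∈ {5,7}` and a `μ = 0` shape at `p = 3`** (the `3Ns/3Nn`
pairs of the N7 residue; no route constant exists for them yet — the shape is Greenberg's `μ = 0` at the
non-surjective X11a pairs with `p = 3`). Twelve facts + `hB`. CONDITIONAL; closes nothing by itself.
[cite: GreenbergLNM1716, §1 Conj. 1.11 (shape)] [cite: BalakrishnanEtAl2019, §1 Thm. 1.2 (arXiv:1711.05846 p. 2)]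
[cite: Kato2004Asterisque, §17.13 (pp. 279–280)] [cite: Wuthrich2014, Cor. 18 (p. 398)] [cite: SteinWuthrich2013, Thm. 6.1 (p. 20)] -/
theorem x11aNonSurjEulerHalf_of_nonSurjCornerTwinMu_of_muZeroAtThree
    (hJs : thm61_splitMultiplicative) (hJn : thm61_nonsplitMultiplicative)
    (hGZK : rank_eq_analyticRank_of_analyticRank_le_one) (hmod : hasEntireLFunction_rat)
    (hpar : nonempty_modularParametrizationData)
    (hGS : ∀ (W : WeierstrassCurve ℚ) [W.IsElliptic] [W.IsGloballyMinimal] (p : ℕ) [Fact p.Prime],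
      greenberg_stevens (W := W) (p := p))
    (hne : Kato2004.nonempty_iwasawaH1Data) (h12 : Kato2004.thm12_4)
    (hns : Kato2004.exists_multDivisibilityInputs_nonsplit)
    (hsp : Kato2004.exists_multDivisibilityInputs_split)
    (h15 : thm15_isTorsion_multiplicative_rat)
    (h18 : Wuthrich2014.corollary18_padicLFunction_mem_iwasawaAlgebra_multiplicative)
    (hB : thm12_not_le_normalizer_splitCartan) (h57 : NonSurjCornerTwinMu)
    (h3 : ∀ (W : WeierstrassCurve ℚ) [W.IsElliptic] [W.IsGloballyMinimal] [Fact (Nat.Prime 3)],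
      ClassX11a W 3 → ¬ Surj W 3 →
      ∀ (κ : ZpExtension ℚ 3) (γ : Field.absoluteGaloisGroup ℚ),
        κ.IsCyclotomic → κ.IsTopGenerator γ → IsCyclotomicVariable 3 γ →
        ∀ D : W.SelmerDualData κ γ, D.mu = 0) :
    Summit.BirchSwinnertonDyer.BirchSwinnertonDyer.Theses.PrintX11a.X11aNonSurjEulerHalf := by
  refine x11aNonSurjEulerHalf_of_three_of_five ?_
    (x11aNonSurjEulerHalf_five_of_nonSurjCornerTwinMu hJs hJn hGZK hmod hpar hGS hne h12 hns hsp h15 h18 hB h57)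
  intro W _ _ p _ hX hnsj hp3
  subst hp3
  exact missingUpperBoundAt_of_katoFacts_of_corollary18_of_mu_eq_zero hJs hJn hGZK hmod hpar hne h12 hns hsp
    h15 h18 W 3 (hGS W 3) hX.ne_two hX.mult hX.analyticRank_eq_zero (h3 W hX hnsj)

/-! ### §6 The per-pair door on the unit-value locus at a NON-SPLIT prime -/

/-- **At a NON-SPLIT non-surjective X11a pair whose Néron-normalised special value `L(E,1)/Ω_E` is a `p`-adic
unit, the Euler-system half holds modulo the thirteen facts.** The constant term of `ϖ·L` is
`2·ϖ·[0]⁺_f = 2·L(E,1)/Ω_E` (no exceptional zero at `a_p = −1`; MTT §I.10, Greenberg LNM 1716 §4 «`l_v = 2`»),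
so a unit special value IS the analytic certificate (`MuAnUnit.exists_norm_coeff_eq_one_of_neg_one_of_padicValRat_eq_zero`,
corner-p1 g7), and §4's chain applies at the pair. The displayed per-pair datum is ONE rational number `t` with
`L(E,1)/Ω_E = t` and `ord_p t = 0` (for `W` of analytic rank `0`: `t = #Ш_an·∏c_ℓ/#E(ℚ)_tors²`, Miller's
currency; ty3's record field `lRatio`). CONDITIONAL on the facts; nothing asserted about any particular curve.
[cite: MazurTateTeitelbaum1986, §I.10 and §I.14] [cite: GreenbergLNM1716, §4 (PDF p. 113)]
[cite: Wuthrich2014, Cor. 18 (p. 398)] [cite: Kato2004Asterisque, §17.13 (pp. 279–280)]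
[cite: SteinWuthrich2013, Thm. 6.1 (p. 20)] [cite: Miller2011LMS, Def. 1.1] -/
theorem x11a_missingUpperBoundAt_of_not_surj_of_nonsplit_of_unit_value
    (hJs : thm61_splitMultiplicative) (hJn : thm61_nonsplitMultiplicative)
    (hGZK : rank_eq_analyticRank_of_analyticRank_le_one) (hmod : hasEntireLFunction_rat)
    (hpar : nonempty_modularParametrizationData)
    (hne : Kato2004.nonempty_iwasawaH1Data) (h12 : Kato2004.thm12_4)
    (hns : Kato2004.exists_multDivisibilityInputs_nonsplit)
    (hsp : Kato2004.exists_multDivisibilityInputs_split)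
    (h15 : thm15_isTorsion_multiplicative_rat)
    (h18 : Wuthrich2014.corollary18_padicLFunction_mem_iwasawaAlgebra_multiplicative)
    (hfine : Kato2004.exists_multDivisibilityInputs_fine)
    (W : WeierstrassCurve ℚ) [W.IsElliptic] [W.IsGloballyMinimal] (p : ℕ) [Fact p.Prime]
    (hGS : greenberg_stevens (W := W) (p := p))
    (hX : ClassX11a W p) (hnsj : ¬ Surj W p) (hnsp : ¬ W.HasSplitMultiplicativeReductionAtPrime p)
    (t : ℚ) (ht : W.entireLFunction 1 / (W.realPeriodRat : ℂ) = (t : ℂ)) (hunit : padicValRat p t = 0) :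
    Typed.MissingUpperBoundAt W p := by
  have hp2 : p ≠ 2 := hX.ne_two
  have hL1 : W.entireLFunction 1 ≠ 0 := hX.L_one_ne_zero hmod
  have hΩpos : 0 < W.realPeriodRat := W.realPeriodRat_pos_holds
  have hΩC : (W.realPeriodRat : ℂ) ≠ 0 := Complex.ofReal_ne_zero.mpr hΩpos.ne'
  have ht0 : t ≠ 0 := by
    rintro rfl
    apply hL1
    rw [← div_mul_cancel₀ (W.entireLFunction 1) hΩC, ht]
    simp
  refine missingUpperBoundAt_of_classX11a_of_multDivisibilityAt hJs hJn hGZK hmod hpar W p hGS hX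
    (multDivisibilityAt_of_katoFacts_of_muAn hne h12 hns hsp h15 h18 hfine W p hp2 hX.mult hX.irr hnsj ?_)
  intro N _ f hf ϖ hϖ a L _ hna hL
  -- at the non-split prime `a = -1`
  have ha : a = -1 := hna hnsp
  subst ha
  -- `ϖ · [0]⁺_f = L(E,1)/Ω_E = t`
  have hLval : W.entireLFunction 1 = ((((ratPlusSymbol f 0 : ℚ) : ℝ) * plusPeriod f : ℝ) : ℂ) :=
    hf.entireLFunction_one_eq
  have hq : W.entireLFunction 1 / (W.realPeriodRat : ℂ) = (((ϖ * ratPlusSymbol f 0 : ℚ)) : ℂ) := by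
    rw [hLval, ← hϖ, div_eq_iff hΩC]
    push_cast
    ring
  have hteq : ϖ * ratPlusSymbol f 0 = t := by
    have h := ht.symm.trans hq
    exact_mod_cast h.symm
  exact MuAnUnit.exists_norm_coeff_eq_one_of_neg_one_of_padicValRat_eq_zero hp2 hL ϖ (hteq ▸ ht0)
    (hteq ▸ hunit)

end Summit.BirchSwinnertonDyer.BirchSwinnertonDyer.Theorems

end
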